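import Summits.Ventures.Crystal3D.Theorems.StickyWulffConstantTextureLiminfTexShadowMixCorner
import Summits.Ventures.Crystal3D.Theorems.StickyWulffConstantTextureLiminfLineCountGlueMix
import HarnessLib

/-!
# TexShadow v6.12 §2c — the generic wall part re-cut as ZIG-COVERED ∪ ROW-COVERED ∪ ON-REACH (definitions + proved glue)
# (lane T, crux `TextureLiminf`, stmt-Ventures-19483; cf-p1 DECISION (xxxvii‴), ROUTE.md §86(104) CU; `BilayerWallDeficient` deleted)

HONEST FRAMING. Venture `Summits/Ventures/Crystal3D` (cell `crystal3d-full`), helper `--supports` the crux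
`TextureLiminf` (stmt-Ventures-19483) of `route-Ventures-StickyWulffConstant`, registered line `TexShadow`.  Rung credit
only; F-C1 not moved.  DEFINITIONS plus proved glue; NOT the wall law.  The ROW family's off-reach predicate is lane G's to
type (19480-p2 g8: `BarlowRowOffReach`, like `BarlowOffReach` with `famSlot ↦ bestLayerDir`); until it is in the tree it enters
here as an explicit PARAMETER `OffR` (one predicate on the plate pair: «the chosen family pair is off-reach»), so that v6.12 pins it
in one line.

THE RE-CUT.  By ZIGZAG OR ROWS (`layerSteep_or_deltaSteep`, p655633) each plate takes a DETERMINISTIC family: ROWS if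
`RowSteep L z := √2/2 ≤ layerRise L z`, else ZIGZAGS (then the plate is Δ-steep and every zigzag step rises `≥ √2/2`).  So:
* `BilayerWallRowCovered OffR C R₀` — generic pairs with AT LEAST ONE row-steep plate whose chosen pair is off-reach (`OffR`) satisfy
  the cell inequality for every admissible table (no domination hypothesis: `mixCorner_of_le_one` supplies it);
* `BilayerWallOnReachRow OffR C R₀` — the same pairs with `¬ OffR` (row reach obstructed: T's lane-F analogue, row version);
* `BilayerWallOnReachZig C R₀` — NEITHER plate row-steep (hence both Δ-steep) and `¬ BarlowOffReach` (= v6.9's on-reach class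
  restricted to the zig corner);
* the `…From R` versions, and the PROVED glue **`bilayerWallGeneric_of_zig_row_onReach`**:
  `WalkerCoveredFrom R_W` (closed mod {E1, StarPairFar}, p654251) `∧ RowCoveredFrom ∧ OnReachRowFrom ∧ OnReachZigFrom ⇒ BilayerWallGenericFrom`
  (in the zig corner `FluxDominated (√2/2)` holds for every table `c ≤ 1` by `one_le_layerFlux_or_plateFlux`);
* the corner weights `cornerA / cornerB` (`(1,0)` zig, `(0,1)` rows) and the T-side closing of the row-covered part from WEIGHTED
  line counts: **`bilayerWallRowCoveredFrom_of_lineCounts`** (`bilayerWallAt_of_lineCount_mix`, p655746) — the by-name target of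
  lane G's row F4 (`barlow_rowCount_le_payers`), exactly as `bilayerWallWalkerCoveredFrom_of_orientedLineCounts` was for zig|zig.
WHAT THIS IS NOT: not the row F4, not `OffR`'s definition (lane G); not the residual class; F-C1 not moved.
-/

noncomputable section

open scoped BigOperators InnerProductSpace ENNReal
open MeasureTheory Filter

namespace Summit.Ventures.Crystal3D.Cruxes.TextureLiminf.TexShadow

open Summit.Ventures.Crystal3D Summit.Ventures.Crystal3D.Theorems
open Literature.MathematicalPhysics.StatisticalMechanics (IsHaggSeq triangularVec₁ triangularVec₂)

/-! ## The deterministic corner -/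

/-- Plate `(L, ·)` walked toward `z` takes the ROW family: its in-layer rows are steep, `√2/2 ≤ layerRise L z`. -/
def RowSteep (L : E3 ≃ₗᵢ[ℝ] E3) (z : E3) : Prop := Real.sqrt 2 / 2 ≤ layerRise L z

open scoped Classical in
/-- zigzag weight of the plate's corner: `0` if row-steep, else `1`. -/
def cornerA (L : E3 ≃ₗᵢ[ℝ] E3) (z : E3) : ℝ := if RowSteep L z then 0 else 1

open scoped Classical in
/-- row weight of the plate's corner: `1` if row-steep, else `0`. -/
def cornerB (L : E3 ≃ₗᵢ[ℝ] E3) (z : E3) : ℝ := if RowSteep L z then 1 else 0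

/-! ## The three parts of the generic wall law (v6.12) -/

/-- **ROW-COVERED PART** at `(C, R₀)`, for the row-pair off-reach predicate `OffR` (lane G's, a parameter here): generic pairs with
at least one row-steep plate whose chosen family pair (rows if steep, else zigzags, per plate) is off-reach. -/
def BilayerWallRowCovered (OffR : (E3 ≃ₗᵢ[ℝ] E3) → E3 → (ℤ → ℤ) → (E3 ≃ₗᵢ[ℝ] E3) → E3 → (ℤ → ℤ) → Prop) (C R₀ : ℝ) : Prop :=
  ∀ (σ₁ σ₂ : ℤ → ℤ), IsHaggSeq σ₁ → IsHaggSeq σ₂ →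
    ∀ (L₁ L₂ : E3 ≃ₗᵢ[ℝ] E3) (s₁ s₂ : E3) (A₁ A₂ : ℤ → (E3 ≃ₗᵢ[ℝ] E3)) (u₁ u₂ : ℤ → E3),
    BilayerFramesAt L₁ s₁ σ₁ A₁ u₁ → BilayerFramesAt L₂ s₂ σ₂ A₂ u₂ →
    (∀ i j : ℤ, ¬ InResidualClass (A₁ i) (A₂ j) (u₁ i) (u₂ j)) →
    (RowSteep L₁ e₃ ∨ RowSteep L₂ (-e₃)) → OffR L₁ s₁ σ₁ L₂ s₂ σ₂ →
    ∀ (c : ℤ → ℤ → ℝ) (m : ℤ → ℤ → E3), BilayerChargeAdmissible A₁ A₂ c m →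
      BilayerWallAt C R₀ σ₁ σ₂ L₁ L₂ s₁ s₂ c

/-- **ON-REACH PART, ROW CORNER** at `(C, R₀)`: at least one row-steep plate, chosen pair NOT off-reach. -/
def BilayerWallOnReachRow (OffR : (E3 ≃ₗᵢ[ℝ] E3) → E3 → (ℤ → ℤ) → (E3 ≃ₗᵢ[ℝ] E3) → E3 → (ℤ → ℤ) → Prop) (C R₀ : ℝ) : Prop :=
  ∀ (σ₁ σ₂ : ℤ → ℤ), IsHaggSeq σ₁ → IsHaggSeq σ₂ →
    ∀ (L₁ L₂ : E3 ≃ₗᵢ[ℝ] E3) (s₁ s₂ : E3) (A₁ A₂ : ℤ → (E3 ≃ₗᵢ[ℝ] E3)) (u₁ u₂ : ℤ → E3),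
    BilayerFramesAt L₁ s₁ σ₁ A₁ u₁ → BilayerFramesAt L₂ s₂ σ₂ A₂ u₂ →
    (∀ i j : ℤ, ¬ InResidualClass (A₁ i) (A₂ j) (u₁ i) (u₂ j)) →
    (RowSteep L₁ e₃ ∨ RowSteep L₂ (-e₃)) → ¬ OffR L₁ s₁ σ₁ L₂ s₂ σ₂ →
    ∀ (c : ℤ → ℤ → ℝ) (m : ℤ → ℤ → E3), BilayerChargeAdmissible A₁ A₂ c m →
      BilayerWallAt C R₀ σ₁ σ₂ L₁ L₂ s₁ s₂ c

/-- **ON-REACH PART, ZIG CORNER** at `(C, R₀)`: neither plate row-steep (so both Δ-steep by ZIGZAG OR ROWS) and the zigzag pair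
NOT Barlow off-reach (v6.9's on-reach class, restricted to the zig corner). -/
def BilayerWallOnReachZig (C R₀ : ℝ) : Prop :=
  ∀ (σ₁ σ₂ : ℤ → ℤ), IsHaggSeq σ₁ → IsHaggSeq σ₂ →
    ∀ (L₁ L₂ : E3 ≃ₗᵢ[ℝ] E3) (s₁ s₂ : E3) (A₁ A₂ : ℤ → (E3 ≃ₗᵢ[ℝ] E3)) (u₁ u₂ : ℤ → E3),
    BilayerFramesAt L₁ s₁ σ₁ A₁ u₁ → BilayerFramesAt L₂ s₂ σ₂ A₂ u₂ →
    (∀ i j : ℤ, ¬ InResidualClass (A₁ i) (A₂ j) (u₁ i) (u₂ j)) →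
    ¬ RowSteep L₁ e₃ → ¬ RowSteep L₂ (-e₃) → ¬ BarlowOffReach L₁ s₁ σ₁ L₂ s₂ σ₂ →
    ∀ (c : ℤ → ℤ → ℝ) (m : ℤ → ℤ → E3), BilayerChargeAdmissible A₁ A₂ c m →
      BilayerWallAt C R₀ σ₁ σ₂ L₁ L₂ s₁ s₂ c

/-- The row-covered part holds FROM plate thickness `R` on. -/
def BilayerWallRowCoveredFrom (OffR : (E3 ≃ₗᵢ[ℝ] E3) → E3 → (ℤ → ℤ) → (E3 ≃ₗᵢ[ℝ] E3) → E3 → (ℤ → ℤ) → Prop)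
    (R : ℝ) : Prop :=
  ∀ R₀ : ℝ, R ≤ R₀ → ∃ C : ℝ, BilayerWallRowCovered OffR C R₀

/-- The row on-reach part holds FROM plate thickness `R` on. -/
def BilayerWallOnReachRowFrom (OffR : (E3 ≃ₗᵢ[ℝ] E3) → E3 → (ℤ → ℤ) → (E3 ≃ₗᵢ[ℝ] E3) → E3 → (ℤ → ℤ) → Prop)
    (R : ℝ) : Prop :=
  ∀ R₀ : ℝ, R ≤ R₀ → ∃ C : ℝ, BilayerWallOnReachRow OffR C R₀

/-- The zig on-reach part holds FROM plate thickness `R` on. -/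
def BilayerWallOnReachZigFrom (R : ℝ) : Prop := ∀ R₀ : ℝ, R ≤ R₀ → ∃ C : ℝ, BilayerWallOnReachZig C R₀

/-! ## Glue: zig-covered ∪ row-covered ∪ on-reach ⇒ generic -/

/-- In the ZIG corner (neither plate row-steep) every table `c ≤ 1` is zigzag-flux-dominated and both plates are Δ-steep. -/
theorem fluxDominated_of_not_rowSteep {L₁ L₂ : E3 ≃ₗᵢ[ℝ] E3} (σ₁ σ₂ : ℤ → ℤ)
    (h₁ : ¬ RowSteep L₁ e₃) (h₂ : ¬ RowSteep L₂ (-e₃)) (c : ℤ → ℤ → ℝ) (hc1 : ∀ i j, c i j ≤ 1) :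
    DeltaSteep L₁ e₃ ∧ DeltaSteep L₂ (-e₃) ∧ FluxDominated (Real.sqrt 2 / 2) L₁ σ₁ L₂ σ₂ c := by
  obtain ⟨he, hne⟩ := norm_e₃_and_neg
  have key : ∀ (L : E3 ≃ₗᵢ[ℝ] E3) (σ : ℤ → ℤ) (z : E3), ‖z‖ = 1 → ¬ RowSteep L z →
      DeltaSteep L z ∧ ∀ i, 1 ≤ plateFlux (Real.sqrt 2 / 2) L σ z i := by
    intro L σ z hz hrow
    rcases one_le_layerFlux_or_plateFlux L σ hz with h | h
    · exfalso
      unfold layerFlux at h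
      rw [if_neg (show ¬ Real.sqrt 2 / 2 ≤ layerRise L z from hrow)] at h
      linarith
    · exact h
  obtain ⟨hΔ₁, hF₁⟩ := key L₁ σ₁ e₃ he h₁
  obtain ⟨hΔ₂, hF₂⟩ := key L₂ σ₂ (-e₃) hne h₂
  refine ⟨hΔ₁, hΔ₂, fun i j => ?_⟩
  have := hF₁ i; have := hF₂ j; have := hc1 i j
  linarith

/-- **Glue (real proof, v6.12): zig-covered ∪ row-covered ∪ on-reach(row) ∪ on-reach(zig) ⇒ generic.** -/
theorem bilayerWallGeneric_of_zig_row_onReach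
    {OffR : (E3 ≃ₗᵢ[ℝ] E3) → E3 → (ℤ → ℤ) → (E3 ≃ₗᵢ[ℝ] E3) → E3 → (ℤ → ℤ) → Prop}
    {R_W R_R R_OR R_OZ : ℝ} (hW1 : 1 ≤ R_W) (hW : BilayerWallWalkerCoveredFrom R_W)
    (hR : BilayerWallRowCoveredFrom OffR R_R) (hOR : BilayerWallOnReachRowFrom OffR R_OR)
    (hOZ : BilayerWallOnReachZigFrom R_OZ) :
    BilayerWallGenericFrom (max (max R_W R_R) (max R_OR R_OZ)) := by
  classical
  intro R₀ hR₀
  have hR₀W : R_W ≤ R₀ := le_trans (le_trans (le_max_left _ _) (le_max_left _ _)) hR₀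
  have hR₀R : R_R ≤ R₀ := le_trans (le_trans (le_max_right _ _) (le_max_left _ _)) hR₀
  have hR₀OR : R_OR ≤ R₀ := le_trans (le_trans (le_max_left _ _) (le_max_right _ _)) hR₀
  have hR₀OZ : R_OZ ≤ R₀ := le_trans (le_trans (le_max_right _ _) (le_max_right _ _)) hR₀
  have hR₀0 : 0 ≤ R₀ := by linarith
  obtain ⟨C₁, hC₁⟩ := hW R₀ hR₀W
  obtain ⟨C₂, hC₂⟩ := hR R₀ hR₀R
  obtain ⟨C₃, hC₃⟩ := hOR R₀ hR₀OR
  obtain ⟨C₄, hC₄⟩ := hOZ R₀ hR₀OZ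
  refine ⟨max (max C₁ C₂) (max C₃ C₄), ?_⟩
  intro σ₁ σ₂ hσ₁ hσ₂ L₁ L₂ s₁ s₂ A₁ A₂ u₁ u₂ hu₁ hu₂ hgen c m hadm
  by_cases hrow : RowSteep L₁ e₃ ∨ RowSteep L₂ (-e₃)
  · by_cases hoff : OffR L₁ s₁ σ₁ L₂ s₂ σ₂
    · exact bilayerWallAt_mono hR₀0 (le_trans (le_max_right _ _) (le_max_left _ _))
        (hC₂ σ₁ σ₂ hσ₁ hσ₂ L₁ L₂ s₁ s₂ A₁ A₂ u₁ u₂ hu₁ hu₂ hgen hrow hoff c m hadm)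
    · exact bilayerWallAt_mono hR₀0 (le_trans (le_max_left _ _) (le_max_right _ _))
        (hC₃ σ₁ σ₂ hσ₁ hσ₂ L₁ L₂ s₁ s₂ A₁ A₂ u₁ u₂ hu₁ hu₂ hgen hrow hoff c m hadm)
  · push Not at hrow
    obtain ⟨h₁, h₂⟩ := hrow
    by_cases hoff : BarlowOffReach L₁ s₁ σ₁ L₂ s₂ σ₂
    · obtain ⟨hΔ₁, hΔ₂, hflux⟩ := fluxDominated_of_not_rowSteep σ₁ σ₂ h₁ h₂ c hadm.2.1
      exact bilayerWallAt_mono hR₀0 (le_trans (le_max_left _ _) (le_max_left _ _))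
        (hC₁ σ₁ σ₂ hσ₁ hσ₂ L₁ L₂ s₁ s₂ A₁ A₂ u₁ u₂ hu₁ hu₂ hgen ⟨hΔ₁, hΔ₂, hoff⟩ c m hadm hflux)
    · exact bilayerWallAt_mono hR₀0 (le_trans (le_max_right _ _) (le_max_right _ _))
        (hC₄ σ₁ σ₂ hσ₁ hσ₂ L₁ L₂ s₁ s₂ A₁ A₂ u₁ u₂ hu₁ hu₂ hgen h₁ h₂ hoff c m hadm)

/-! ## The row-covered part from WEIGHTED line counts (by-name target of lane G's row F4) -/

/-- Corner weights lie in `[0, 1]`. -/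
theorem corner_bounds (L : E3 ≃ₗᵢ[ℝ] E3) (z : E3) :
    0 ≤ cornerA L z ∧ cornerA L z ≤ 1 ∧ 0 ≤ cornerB L z ∧ cornerB L z ≤ 1 := by
  unfold cornerA cornerB
  split_ifs <;> norm_num

/-- **At the deterministic corner every table `c ≤ 1` is MIX-dominated** (rows steep ⇒ `layerFlux ≥ 1`; else every `plateFlux ≥ 1`). -/
theorem mixFluxDominated_corner (L₁ L₂ : E3 ≃ₗᵢ[ℝ] E3) (σ₁ σ₂ : ℤ → ℤ) (c : ℤ → ℤ → ℝ) (hc1 : ∀ i j, c i j ≤ 1) :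
    MixFluxDominated (Real.sqrt 2 / 2) (cornerA L₁ e₃) (cornerB L₁ e₃) (cornerA L₂ (-e₃)) (cornerB L₂ (-e₃)) L₁ σ₁ L₂ σ₂ c := by
  obtain ⟨he, hne⟩ := norm_e₃_and_neg
  have hs2 : 0 < Real.sqrt 2 := Real.sqrt_pos.2 (by norm_num)
  have h2 : Real.sqrt 2 ^ 2 = 2 := Real.sq_sqrt (by norm_num)
  -- per plate: the corner's flux profile is `≥ 1`
  have plate : ∀ (L : E3 ≃ₗᵢ[ℝ] E3) (σ : ℤ → ℤ) (z : E3), ‖z‖ = 1 →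
      ∀ i, 1 ≤ cornerA L z * plateFlux (Real.sqrt 2 / 2) L σ z i + cornerB L z * layerFlux (Real.sqrt 2 / 2) L z := by
    intro L σ z hz i
    unfold cornerA cornerB
    by_cases hrow : RowSteep L z
    · rw [if_pos hrow, if_pos hrow, zero_mul, one_mul, zero_add]
      unfold layerFlux
      rw [if_pos (show Real.sqrt 2 / 2 ≤ layerRise L z from hrow)]
      have : Real.sqrt 2 / 2 ≤ layerRise L z := hrow
      nlinarith
    · rw [if_neg hrow, if_neg hrow, zero_mul, one_mul, add_zero]
      rcases one_le_layerFlux_or_plateFlux L σ hz with h | ⟨-, h⟩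
      · exfalso
        unfold layerFlux at h
        rw [if_neg (show ¬ Real.sqrt 2 / 2 ≤ layerRise L z from hrow)] at h
        linarith
      · exact h i
  intro i j
  have := plate L₁ σ₁ e₃ he i; have := plate L₂ σ₂ (-e₃) hne j; have := hc1 i j
  linarith

/-- **The row-covered wall law from weighted line counts** (T-side closing of `BilayerWallRowCovered` BY NAME, modulo lane G's row
F4): if for every `R₀ ≥ R` one rim constant `C_w` serves every Hägg pair / frame pair / origin pair with at least one row-steep plate
and `OffR`, in the shape «∃ zig selectors `step₁ step₂`, and per cell ∃ `m ≥ 0`, `T₁ T₂` (zig window lines), `T₃ T₄` (window rows) with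
`cornerA₁·#T₁ + cornerA₂·#T₂ + cornerB₁·#T₃ + cornerB₂·#T₄ + 36mρ ≤ Σ_PAY(12 − deg) + C_w(1+h)ρ`», then `BilayerWallRowCoveredFrom OffR R`
(`R ≥ 3`; rim constant `(C_w + 160(R₀+9) + 3456 + 1152(R₀+1))/2`). -/
theorem bilayerWallRowCoveredFrom_of_lineCounts
    (OffR : (E3 ≃ₗᵢ[ℝ] E3) → E3 → (ℤ → ℤ) → (E3 ≃ₗᵢ[ℝ] E3) → E3 → (ℤ → ℤ) → Prop) (R : ℝ) (hR : 3 ≤ R)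
    (hlines : ∀ R₀ : ℝ, R ≤ R₀ → ∃ C_w : ℝ, ∀ (σ₁ σ₂ : ℤ → ℤ), IsHaggSeq σ₁ → IsHaggSeq σ₂ →
      ∀ (L₁ L₂ : E3 ≃ₗᵢ[ℝ] E3) (s₁ s₂ : E3), (RowSteep L₁ e₃ ∨ RowSteep L₂ (-e₃)) → OffR L₁ s₁ σ₁ L₂ s₂ σ₂ →
      ∃ step₁ step₂ : ℤ → E3, IsZigSelector L₁ σ₁ e₃ step₁ ∧ IsZigSelector L₂ σ₂ (-e₃) step₂ ∧
      ∀ h : ℝ, 0 ≤ h → ∀ ρ : ℝ, R₀ ≤ ρ → ∀ X P₁ P₂ : Finset E3,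
      (∀ p ∈ X, ∀ q ∈ X, p ≠ q → 1 ≤ dist p q) → P₁ ⊆ X → P₂ ⊆ X \ P₁ → (∀ p ∈ X, p ∈ cyl R₀ h ρ) →
      (∀ p, p ∈ P₁ ↔ (p ∈ stacking L₁ s₁ σ₁ ∧ -(2 * R₀) ≤ p 2 ∧ p 2 ≤ -R₀ ∧ p 0 ^ 2 + p 1 ^ 2 ≤ ρ ^ 2)) →
      (∀ p, p ∈ P₂ ↔ (p ∈ stacking L₂ s₂ σ₂ ∧ h + R₀ ≤ p 2 ∧ p 2 ≤ h + 2 * R₀ ∧ p 0 ^ 2 + p 1 ^ 2 ≤ ρ ^ 2)) →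
      ∃ (m : ℝ) (T₁ T₂ : Finset (Fin 2 → ℤ)) (T₃ T₄ : Finset (ℤ × ℤ)), 0 ≤ m ∧
        (∀ t : Fin 2 → ℤ, (∃ k : ℤ,
          -R₀ - 4 ≤ (L₁ (zigVertexS step₁ k + ((t 0 : ℝ) • triangularVec₁ 1 + (t 1 : ℝ) • triangularVec₂ 1)) + s₁) 2 ∧
          (L₁ (zigVertexS step₁ k + ((t 0 : ℝ) • triangularVec₁ 1 + (t 1 : ℝ) • triangularVec₂ 1)) + s₁) 2 ≤ -R₀ - 3 ∧
          Real.sqrt ((L₁ (zigVertexS step₁ k + ((t 0 : ℝ) • triangularVec₁ 1 + (t 1 : ℝ) • triangularVec₂ 1)) + s₁) 0 ^ 2 +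
            (L₁ (zigVertexS step₁ k + ((t 0 : ℝ) • triangularVec₁ 1 + (t 1 : ℝ) • triangularVec₂ 1)) + s₁) 1 ^ 2) ≤ ρ - m) →
          t ∈ T₁) ∧
        (∀ t : Fin 2 → ℤ, (∃ k : ℤ,
          h + R₀ + 3 ≤ (L₂ (zigVertexS step₂ k + ((t 0 : ℝ) • triangularVec₁ 1 + (t 1 : ℝ) • triangularVec₂ 1)) + s₂) 2 ∧
          (L₂ (zigVertexS step₂ k + ((t 0 : ℝ) • triangularVec₁ 1 + (t 1 : ℝ) • triangularVec₂ 1)) + s₂) 2 ≤ h + R₀ + 4 ∧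
          Real.sqrt ((L₂ (zigVertexS step₂ k + ((t 0 : ℝ) • triangularVec₁ 1 + (t 1 : ℝ) • triangularVec₂ 1)) + s₂) 0 ^ 2 +
            (L₂ (zigVertexS step₂ k + ((t 0 : ℝ) • triangularVec₁ 1 + (t 1 : ℝ) • triangularVec₂ 1)) + s₂) 1 ^ 2) ≤ ρ - m) →
          t ∈ T₂) ∧
        (∀ kj : ℤ × ℤ, (∃ i : ℤ,
          -R₀ - 4 ≤ (L₁ (layerSite σ₁ L₁ e₃ kj.1 i kj.2) + s₁) 2 ∧ (L₁ (layerSite σ₁ L₁ e₃ kj.1 i kj.2) + s₁) 2 ≤ -R₀ - 3 ∧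
          Real.sqrt ((L₁ (layerSite σ₁ L₁ e₃ kj.1 i kj.2) + s₁) 0 ^ 2 + (L₁ (layerSite σ₁ L₁ e₃ kj.1 i kj.2) + s₁) 1 ^ 2) ≤
            ρ - m) → kj ∈ T₃) ∧
        (∀ kj : ℤ × ℤ, (∃ i : ℤ,
          h + R₀ + 3 ≤ (L₂ (layerSite σ₂ L₂ (-e₃) kj.1 i kj.2) + s₂) 2 ∧
          (L₂ (layerSite σ₂ L₂ (-e₃) kj.1 i kj.2) + s₂) 2 ≤ h + R₀ + 4 ∧
          Real.sqrt ((L₂ (layerSite σ₂ L₂ (-e₃) kj.1 i kj.2) + s₂) 0 ^ 2 +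
            (L₂ (layerSite σ₂ L₂ (-e₃) kj.1 i kj.2) + s₂) 1 ^ 2) ≤ ρ - m) → kj ∈ T₄) ∧
        cornerA L₁ e₃ * (T₁.card : ℝ) + cornerA L₂ (-e₃) * T₂.card + cornerB L₁ e₃ * T₃.card + cornerB L₂ (-e₃) * T₄.card +
            36 * m * ρ ≤
          (∑ y ∈ X.filter (fun y => (X.filter fun q => dist y q = 1).card ≠ 12 ∧ -R₀ - 2 ≤ y 2 ∧ y 2 ≤ h + R₀ + 2),
            ((12 : ℝ) - ((X.filter fun q => dist y q = 1).card : ℝ))) + C_w * (1 + h) * ρ) :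
    BilayerWallRowCoveredFrom OffR R := by
  intro R₀ hR₀
  obtain ⟨C_w, hC⟩ := hlines R₀ hR₀
  refine ⟨(C_w + 160 * (R₀ + 9) + 3456 + 1152 * (R₀ + 1)) / 2, ?_⟩
  intro σ₁ σ₂ hσ₁ hσ₂ L₁ L₂ s₁ s₂ A₁ A₂ u₁ u₂ _hA₁ _hA₂ _hgen hrow hoff c m hadm
  obtain ⟨step₁, step₂, hsel₁, hsel₂, hF4⟩ := hC σ₁ σ₂ hσ₁ hσ₂ L₁ L₂ s₁ s₂ hrow hoff
  obtain ⟨ha₁, ha₁1, hb₁, hb₁1⟩ := corner_bounds L₁ e₃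
  obtain ⟨ha₂, ha₂1, hb₂, hb₂1⟩ := corner_bounds L₂ (-e₃)
  have hτ : (1 : ℝ) / 4 ≤ Real.sqrt 2 / 2 := by have := Real.one_lt_sqrt_two; linarith
  exact bilayerWallAt_of_lineCount_mix hσ₁ hσ₂ L₁ L₂ s₁ s₂ (Real.sqrt 2 / 2) R₀ C_w hτ (le_trans hR hR₀)
    ha₁ ha₁1 hb₁ hb₁1 ha₂ ha₂1 hb₂ hb₂1 c hadm.1 (mixFluxDominated_corner L₁ L₂ σ₁ σ₂ c hadm.2.1) hsel₁ hsel₂ hF4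

end Summit.Ventures.Crystal3D.Cruxes.TextureLiminf.TexShadow

end
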